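import Summits.HodgeConjecture.HodgeConjecture.Theorems.K2LiuIntertwiningConvergesOfParabolic   -- ★ p06: socket mod {E5′, (C0)}
import Summits.HodgeConjecture.HodgeConjecture.Theorems.K2LiuUnipotentCocompact                 -- ★ p06: (C0)
import HarnessLib

/-!
# O41.3 «the Siegel intertwining integral converges on `Re s > n/2`» — closed MODULO Godement's parabolic integral (E5′) ONLY

Track B ∕ hLiu418 = stmt-HodgeConjecture-24832, line `K2_Liu_CurveThetaSigs`, unit U7 «CONTINUATION ORGANS of #41», socket O41.3
`sig_K2LiuIntertwiningConverges` (`Cruxes/HLiu418/Lines/K2_Liu_CurveThetaSigs_U7_ContinuationOrgans.lean` ED. 1 :57), seat `hodgecm-mathlib-K2Liu-p06`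
(g0), LEAD F0P6-plan deal 2026-09-03T23:05:23Z.  With the cocompactness (C0) of `N_Δ(L⁺)` in `N_Δ(𝔸)` now proved
(★ `K2LiuUnipotentCocompact.exists_isCompact_cover_unipDelta`), the assembly ★ `K2LiuIntertwiningConvergesOfParabolic` leaves ONE binder:

**`integrable_weylDelta_mul_of_parabolic`** — for a unitary `χ`, `Re s > n/2`, a continuous Siegel section `f ∈ I_Δ(s, χ)`, a Haar measure `νN` on
`N_Δ(𝔸)` and `h ∈ H(𝔸)`: GIVEN Godement's parabolic integral (E5′ — K2Liu-p09's remaining stub of socket #9, type verbatim), the intertwining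
integrand `u ↦ f(w_Δ u h)` is `νN`-integrable.  So the O41.3 socket and socket #9 now rest on the SAME single named input (E5′).
[MoeglinWaldspurger1995, II.1.6].

Theorems only; axioms ⊆ {propext, Classical.choice, Quot.sound}.

## References
* C. Moeglin, J.-L. Waldspurger, *Spectral decomposition and Eisenstein series* (1995), II.1.5–II.1.6 [MoeglinWaldspurger1995].

HONEST LABEL: HC_CM is proved only modulo the 7 printed citations (2 remaining named inputs: hLiu418 = stmt-HodgeConjecture-24832,
h413 = stmt-HodgeConjecture-24833) until rung 0 closes; this helper closes O41.3 only modulo (E5′) and moves no counter.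
-/

set_option autoImplicit false
set_option linter.dupNamespace false

noncomputable section

open scoped Matrix ENNReal NNReal
open NumberField IsDedekindDomain MeasureTheory

namespace Summit.HodgeConjecture.HodgeConjecture.Cruxes.HLiu418.K2LiuIntertwiningConvergesOfE5

open Literature.NumberTheory.Automorphic Literature.NumberTheory.GaloisRepresentations
open Literature.NumberTheory.GelbartRogawski1991 Literature.NumberTheory.GelbartRogawski1991.GRConstruction
open Literature.NumberTheory.K2Lit.SiegelDoubled
open Literature.MeasureTheory.Group
open Summit.HodgeConjecture.HodgeConjecture.Cruxes.HLiu418.K2LiuIntertwiningConvergesOfParabolic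
open Summit.HodgeConjecture.HodgeConjecture.Cruxes.HLiu418.K2LiuUnipotentCocompact

variable (L : Type) [Field L] [NumberField L] [IsCMField L]
variable {N M n : ℕ} (e : Fin N × Fin M ≃ Fin n)
  (dV : Fin N → L) (hdV : ∀ i, IsCMField.complexConj L (dV i) = dV i)
  (dW : Fin M → L) (hdW : ∀ i, IsCMField.complexConj L (dW i) = dW i)

/-- **O41.3 CLOSED MODULO (E5′).**  Given Godement's parabolic integral on `P_Δ(𝔸)` (K2Liu-p09's stub `stub_E5'_parabolicIntegral`, bytes
verbatim, for all `τ > 2n`), the Siegel intertwining integrand `u ↦ f(w_Δ u h)` is Haar-integrable on `N_Δ(𝔸)` for every unitary `χ`,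
`Re s > n/2`, continuous Siegel section `f ∈ I_Δ(s, χ)` and `h ∈ H(𝔸)` — the conclusion of socket `sig_K2LiuIntertwiningConverges`.
[cite: MoeglinWaldspurger1995, II.1.6 (Prop. (i) and its proof)] -/
theorem integrable_weylDelta_mul_of_parabolic (hdV0 : ∀ i, dV i ≠ 0) (hdW0 : ∀ i, dW i ≠ 0)
    {χ : HeckeCharacter L} (hχ : χ.IsUnitary) {s : ℂ} (hs : (n : ℝ) / 2 < s.re)
    {f : HA L e dV hdV dW hdW → ℂ} (hf : IsSiegelDeltaSection L e dV hdV dW hdW χ s f) (hfc : Continuous f)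
    [MeasurableSpace (unipDelta L e dV hdV dW hdW)] [BorelSpace (unipDelta L e dV hdV dW hdW)]
    (νN : Measure (unipDelta L e dV hdV dW hdW)) [νN.IsHaarMeasure]
    (hE5' : ∀ [MeasurableSpace (HA L e dV hdV dW hdW)] [BorelSpace (HA L e dV hdV dW hdW)] (τ : ℝ), 2 * (n : ℝ) < τ →
      ∃ (μP : Measure (siegelDelta L e dV hdV dW hdW : Subgroup (HA L e dV hdV dW hdW))) (_ : μP.IsHaarMeasure)
        (w₁ : ↥(siegelDelta L e dV hdV dW hdW) → ℝ≥0∞),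
        IsCoveringWeight (↥((ratH L e dV hdV dW hdW).subgroupOf (siegelDelta L e dV hdV dW hdW))) w₁ ∧
        ∀ C₁ : ℝ, ∫⁻ p, {p : ↥(siegelDelta L e dV hdV dW hdW) |
            modDelta L e dV hdV dW hdW (p : HA L e dV hdV dW hdW) ≤ C₁}.indicator
              (fun p => ENNReal.ofReal (modDelta L e dV hdV dW hdW (p : HA L e dV hdV dW hdW) ^ τ)) p * w₁ p ∂μP ≠ ∞)
    (h : HA L e dV hdV dW hdW) :
    Integrable (fun u : unipDelta L e dV hdV dW hdW =>
      f (weylDelta L e dV hdV dW hdW * (u : HA L e dV hdV dW hdW) * h)) νN := by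
  obtain ⟨K, hK, hcover⟩ := exists_isCompact_cover_unipDelta L e dV hdV dW hdW hdV0 hdW0
  exact integrable_weylDelta_mul_of_parabolic_of_cover L e dV hdV dW hdW hdV0 hdW0 hχ hs hf hfc νN hE5' hK hcover h

/-- **The socket's shape, modulo (E5′)**: the statement of `sig_K2LiuIntertwiningConverges` (U7 ED. 1 :57) with Godement's parabolic integral as
its one extra hypothesis, in the socket's binder order — the by-name closer is `fun … => this … (E5′ ★)` once K2Liu-p09's stub lands.
[cite: MoeglinWaldspurger1995, II.1.6] -/
theorem intertwiningConverges_of_parabolic :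
    ∀ (L : Type) [Field L] [NumberField L] [IsCMField L] {N M n : ℕ} (e : Fin N × Fin M ≃ Fin n)
      (dV : Fin N → L) (hdV : ∀ i, IsCMField.complexConj L (dV i) = dV i) (_hdV0 : ∀ i, dV i ≠ 0)
      (dW : Fin M → L) (hdW : ∀ i, IsCMField.complexConj L (dW i) = dW i) (_hdW0 : ∀ i, dW i ≠ 0),
      (∀ [MeasurableSpace (HA L e dV hdV dW hdW)] [BorelSpace (HA L e dV hdV dW hdW)] (τ : ℝ), 2 * (n : ℝ) < τ →
        ∃ (μP : Measure (siegelDelta L e dV hdV dW hdW : Subgroup (HA L e dV hdV dW hdW))) (_ : μP.IsHaarMeasure)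
          (w₁ : ↥(siegelDelta L e dV hdV dW hdW) → ℝ≥0∞),
          IsCoveringWeight (↥((ratH L e dV hdV dW hdW).subgroupOf (siegelDelta L e dV hdV dW hdW))) w₁ ∧
          ∀ C₁ : ℝ, ∫⁻ p, {p : ↥(siegelDelta L e dV hdV dW hdW) |
              modDelta L e dV hdV dW hdW (p : HA L e dV hdV dW hdW) ≤ C₁}.indicator
                (fun p => ENNReal.ofReal (modDelta L e dV hdV dW hdW (p : HA L e dV hdV dW hdW) ^ τ)) p * w₁ p ∂μP ≠ ∞) →
      ∀ (χ : HeckeCharacter L), χ.IsUnitary →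
        ∀ (s : ℂ), (n : ℝ) / 2 < s.re →
          ∀ f : HA L e dV hdV dW hdW → ℂ, IsSiegelDeltaSection L e dV hdV dW hdW χ s f → Continuous f →
            ∀ [MeasurableSpace (unipDelta L e dV hdV dW hdW)] [BorelSpace (unipDelta L e dV hdV dW hdW)]
              (νN : Measure (unipDelta L e dV hdV dW hdW)) [νN.IsHaarMeasure]
              (h : HA L e dV hdV dW hdW),
                Integrable (fun u : unipDelta L e dV hdV dW hdW =>
                  f (weylDelta L e dV hdV dW hdW * (u : HA L e dV hdV dW hdW) * h)) νN :=
  fun L _ _ _ _ _ _ e dV hdV hdV0 dW hdW hdW0 hE5' _ hχ _ hs _ hf hfc _ _ νN _ h =>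
    integrable_weylDelta_mul_of_parabolic L e dV hdV dW hdW hdV0 hdW0 hχ hs hf hfc νN hE5' h

end Summit.HodgeConjecture.HodgeConjecture.Cruxes.HLiu418.K2LiuIntertwiningConvergesOfE5

end
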